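import Summits.CriticalPhenomena.PercolationContinuityZ3.Theorems.PercNearOneGluingNoHeavyLowerTailThreePointProductFormModuleCone

/-!
# THEOREM N′: the 3-dimensional module of the box problem is a COMPLETELY POSITIVE 2×2 matrix pencil —
# `𝕄 ≅ Sym₂(ℚ)` with every letter `M(s,d)` acting by `Y ↦ Σⱼ Dⱼ·Kⱼ(s,d) Y Kⱼ(s,d)ᵀ`, `Kⱼ` linear in `(s,d)`
# (Sahi programme, one-child boundary-star cycle, prover prim-sahi-p2 gen 70)

Support file (`--supports stmt-CriticalPhenomena-4575`).  Standard axioms, no sorries, no named facts.  Memo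
`run/shared/lean/prim/prim-sahi/FROM-prim-sahi-p2-gen70-MODULE-CP.md`, `prim-sahi-p2/PROOF-E3.md` §80.

THE OBJECT.  `𝕄 = ⟨e1, e2, y⟩` is the 3-dimensional module whose three copies form the nine middle states of the 12-state normal form
of the AM form `A = #P1 + #P2 − 2·#bad` (`…ProductFormABPlus`, `…Krein`, `…ModuleCone`); a child with parameters `(u,w)` acts by
`M(s,d) = s²P + d²Q + sdR` (`ProductFormModuleCone.mSD`), `s = u + w`, `d = u − w`.  THEOREM N (gen 69) gave `𝕄` a nonnegative INTEGER
realisation (polyhedral invariant cone `K`).  By the polyhedral no-go N5 every certificate of the box theorem must be CURVED; this file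
gives the module the curved positive structure:

* `i11 / i22 / i12` — the linear isomorphism `ι : 𝕄 → Sym₂(ℚ)`, `ι(x,y,z) = [[4x + 9y, 3z], [3z, x + 4y]]`, and the quadratic form
  `qf v a b = (a,b) ι(v) (a,b)ᵀ`; the cone `L = ι⁻¹(PSD₂)` is `inL v := ∀ a b, 0 ≤ qf v a b` (`inL_iff`: `⟺ 4x+9y ≥ 0 ∧ x+4y ≥ 0 ∧ 9z² ≤ (4x+9y)(x+4y)`).
* ★ `qf_mSD` — THE KRAUS IDENTITY: for ALL rational `s, d` (no physicality), `(a,b) ι(M(s,d)v) (a,b)ᵀ = Σⱼ₌₁⁸ Dⱼ · qf v (ηⱼ)` with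
  `ηⱼ = Kⱼ(s,d)ᵀ(a,b)`, `Kⱼ(s,d) = s·Aⱼ + d·Bⱼ` explicit rational 2×2 matrices and `Dⱼ > 0` — i.e. `ι∘M(s,d)∘ι⁻¹` is the completely positive map
  `Y ↦ Σⱼ Dⱼ Kⱼ Y Kⱼᵀ` with Kraus operators LINEAR in `(s,d)` (equivalently: the 8×8 Gram matrix of the pencil is positive semidefinite;
  certificate found by SDP, kit j345029/j345060, rationalised and re-derived exactly, `gen70/lab70`).
* ★ `inL_mSD`, `inL_iterSD` — consequently the quadratic cone `L` is mapped into itself by EVERY letter `M(s,d)`, `s, d ∈ ℚ` arbitrary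
  (also `|d| > s`), and by every product of letters.  `inL_of_inK` — `K ⊆ L`, the three extreme rays `(3,0,±2), (−9,4,0)` of `K` lying ON the
  boundary conic of `L` (`qf = 3c₁(2a+b)² + 3c₂(2a−b)² + 7c₃b²` in `K`-coordinates): `L` is the round cone circumscribing THEOREM N's `K`.
* `inL_negJump1 / inL_negJump2`, ★ `cols_negL` — for PHYSICAL letters the `t`-proportional jumps of the two `a`-part columns lie in `−L`
  (the 2×2 blocks of `ι(−σₐ)` in `u², 2uw, w²` are positive semidefinite), hence `col1, col2 ∈ −L` along every physical word (as `cols_negK`).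
* ★ `betaM_nonneg_of_inL` — the Krein form `β𝕄` is nonnegative on `L × L` (a certificate of complete-positivity type:
  `β𝕄(u,v) = (19/3136)pp′ + (29/392)(pq′ + qp′) + (3/49)qq′ + (1/9)rr′` in the entries `(p,q,r), (p′,q′,r′)` of `ι(u), ι(v)`, and
  `(29/392)(pq′+qp′) ≥ (29/196)|r r′| ≥ (1/9)|r r′|`) — STRONGER than THEOREM N's acuteness of `K ⊂ L`.
WHY IT MATTERS (memo §2): with three columns `col₁, col₂, col₃ ∈ 𝕄 ≅ Sym₂` moved by the SAME completely positive map, every block matrix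
`Σₐ ι(colₐ) ⊗ Fₐ` (`Fₐ ∈ Sym_m`) is moved by the completely positive map `Φ ⊗ id` plus a `t`-proportional source: this yields an infinite
family of forward-invariant CROSS-COLUMN matrix inequalities (the curved laws the no-go N5 asks for) for free — the input of the gen-70
LEMMA-Q programme.  [this work] (gen 70).
-/

namespace Summit.CriticalPhenomena.PercolationContinuityZ3.Theorems.ProductFormModuleCP

open ProductFormCorners (V3)
open ProductFormABPlus
open ProductFormModuleCone

/-! ## 1. The map `ι : 𝕄 → Sym₂(ℚ)` and the quadratic cone `L = ι⁻¹(PSD₂)` -/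

/-- `(1,1)` entry of `ι(v)`: `4x + 9y`. [this work] -/
def i11 (v : V3) : ℚ := 4 * v.x + 9 * v.y
/-- `(2,2)` entry of `ι(v)`: `x + 4y`. [this work] -/
def i22 (v : V3) : ℚ := v.x + 4 * v.y
/-- off-diagonal entry of `ι(v)`: `3z`. [this work] -/
def i12 (v : V3) : ℚ := 3 * v.z

/-- The quadratic form of the symmetric matrix `ι(v)` at `(a,b)`. [this work] -/
def qf (v : V3) (a b : ℚ) : ℚ := a ^ 2 * i11 v + 2 * a * b * i12 v + b ^ 2 * i22 v

/-- `v ∈ L` iff `ι(v)` is positive semidefinite (quadratic-form definition). [this work] -/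
def inL (v : V3) : Prop := ∀ a b : ℚ, 0 ≤ qf v a b

/-- `L` in terms of the entries: `ι₁₁ ≥ 0`, `ι₂₂ ≥ 0`, `ι₁₂² ≤ ι₁₁ι₂₂`. [this work] -/
theorem inL_iff (v : V3) : inL v ↔ 0 ≤ i11 v ∧ 0 ≤ i22 v ∧ i12 v ^ 2 ≤ i11 v * i22 v := by
  constructor
  · intro h
    have h1 := h 1 0
    have h2 := h 0 1
    simp only [qf] at h1 h2
    have hp : 0 ≤ i11 v := by linarith
    have hq : 0 ≤ i22 v := by linarith
    refine ⟨hp, hq, ?_⟩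
    by_cases hq0 : i22 v = 0
    · -- then `i12 v = 0`: test vector `(i12, −(i11+1)/2)`
      have h3 := h (i12 v) (-(i11 v + 1) / 2)
      simp only [qf, hq0] at h3
      have : i12 v ^ 2 * (i11 v) + 2 * (i12 v) * (-(i11 v + 1) / 2) * i12 v ≥ 0 := by nlinarith
      have h4 : i12 v ^ 2 ≤ 0 := by nlinarith
      have h5 : i12 v = 0 := by nlinarith [sq_nonneg (i12 v)]
      rw [h5, hq0]; norm_num
    · have h3 := h (i22 v) (-(i12 v))
      simp only [qf] at h3
      have hq' : 0 < i22 v := lt_of_le_of_ne hq (Ne.symm hq0)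
      nlinarith
  · rintro ⟨hp, hq, hd⟩ a b
    simp only [qf]
    by_cases hp0 : i11 v = 0
    · have : i12 v ^ 2 ≤ 0 := by rw [hp0] at hd; simpa using hd
      have h5 : i12 v = 0 := by nlinarith [sq_nonneg (i12 v)]
      rw [hp0, h5]; nlinarith [sq_nonneg b]
    · have hp' : 0 < i11 v := lt_of_le_of_ne hp (Ne.symm hp0)
      have key : i11 v * (a ^ 2 * i11 v + 2 * a * b * i12 v + b ^ 2 * i22 v)
          = (a * i11 v + b * i12 v) ^ 2 + b ^ 2 * (i11 v * i22 v - i12 v ^ 2) := by ring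
      have hmul : 0 ≤ i11 v * (a ^ 2 * i11 v + 2 * a * b * i12 v + b ^ 2 * i22 v) := by
        rw [key]; nlinarith [sq_nonneg (a * i11 v + b * i12 v), sq_nonneg b]
      exact (mul_nonneg_iff_of_pos_left hp').mp hmul

/-- `qf` is linear in `v`: additivity. [this work] -/
theorem qf_add (u v : V3) (a b : ℚ) : qf ⟨u.x + v.x, u.y + v.y, u.z + v.z⟩ a b = qf u a b + qf v a b := by
  simp only [qf, i11, i22, i12]; ring

/-- `qf` is linear in `v`: homogeneity. [this work] -/
theorem qf_smul (c : ℚ) (v : V3) (a b : ℚ) : qf ⟨c * v.x, c * v.y, c * v.z⟩ a b = c * qf v a b := by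
  simp only [qf, i11, i22, i12]; ring

/-- `L` is a convex cone: closed under sums. [this work] -/
theorem inL_add {u v : V3} (hu : inL u) (hv : inL v) : inL ⟨u.x + v.x, u.y + v.y, u.z + v.z⟩ := by
  intro a b; rw [qf_add]; exact add_nonneg (hu a b) (hv a b)

/-- `L` is a convex cone: closed under nonnegative scaling. [this work] -/
theorem inL_smul {v : V3} (c : ℚ) (hc : 0 ≤ c) (hv : inL v) : inL ⟨c * v.x, c * v.y, c * v.z⟩ := by
  intro a b; rw [qf_smul]; exact mul_nonneg hc (hv a b)

/-! ## 2. `K ⊆ L`: THEOREM N's simplicial cone is inscribed in the round cone `L` -/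

/-- In `K`-coordinates `qf v a b = 3c₁(2a+b)² + 3c₂(2a−b)² + 7c₃b²`: the three extreme rays of `K` are boundary rays of `L`. [this work] -/
theorem qf_cone (v : V3) (a b : ℚ) :
    qf v a b = 3 * c1 v * (2 * a + b) ^ 2 + 3 * c2 v * (2 * a - b) ^ 2 + 7 * c3 v * b ^ 2 := by
  simp only [qf, i11, i22, i12, c1, c2, c3]; ring

/-- `K ⊆ L`. [this work] -/
theorem inL_of_inK {v : V3} (hv : inK v) : inL v := by
  obtain ⟨h1, h2, h3⟩ := hv
  intro a b
  rw [qf_cone]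
  have := mul_nonneg h1 (sq_nonneg (2 * a + b))
  have := mul_nonneg h2 (sq_nonneg (2 * a - b))
  have := mul_nonneg h3 (sq_nonneg b)
  nlinarith

/-- `−K ⊆ −L` (the form used by the column laws). [this work] -/
theorem inL_neg_of_negK {v : V3} (hv : negK v) : inL ⟨-v.x, -v.y, -v.z⟩ := by
  obtain ⟨h1, h2, h3⟩ := hv
  intro a b
  rw [qf_cone]
  simp only [c1, c2, c3] at *
  nlinarith [mul_nonneg (neg_nonneg.mpr h1) (sq_nonneg (2 * a + b)), mul_nonneg (neg_nonneg.mpr h2) (sq_nonneg (2 * a - b)),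
    mul_nonneg (neg_nonneg.mpr h3) (sq_nonneg b)]

/-! ## 3. ★ The Kraus identity: `ι ∘ M(s,d) ∘ ι⁻¹` is completely positive for ALL `(s,d)` -/

/-- ★ THE KRAUS IDENTITY (8 terms, two parity classes of 4; exact rational weights `Dⱼ > 0` and Kraus operators
`Kⱼ(s,d) = s·Aⱼ + d·Bⱼ`): `(a,b)·ι(M(s,d)v)·(a,b)ᵀ = Σⱼ Dⱼ · (ηⱼ)·ι(v)·(ηⱼ)ᵀ`, `ηⱼ = Kⱼ(s,d)ᵀ(a,b)`.  Valid for every `s, d ∈ ℚ`. [this work] -/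
theorem qf_mSD (s d : ℚ) (v : V3) (a b : ℚ) :
    qf (mSD s d v) a b =
      ((7:ℚ)/4) * qf v ((s * (1:ℚ) + d * (0:ℚ)) * a + (s * (0:ℚ) + d * ((5:ℚ)/392)) * b) ((s * (0:ℚ) + d * ((1:ℚ)/21)) * a + (s * ((1:ℚ)/2) + d * (0:ℚ)) * b)
      + ((25:ℚ)/16) * qf v ((s * (0:ℚ) + d * (0:ℚ)) * a + (s * (0:ℚ) + d * ((-31:ℚ)/420)) * b) ((s * (0:ℚ) + d * ((166:ℚ)/525)) * a + (s * (1:ℚ) + d * (0:ℚ)) * b)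
      + ((8833:ℚ)/98784) * qf v ((s * (0:ℚ) + d * (0:ℚ)) * a + (s * (0:ℚ) + d * (1:ℚ)) * b) ((s * (0:ℚ) + d * ((4396:ℚ)/4015)) * a + (s * (0:ℚ) + d * (0:ℚ)) * b)
      + ((1869121:ℚ)/1609650) * qf v ((s * (0:ℚ) + d * (0:ℚ)) * a + (s * (0:ℚ) + d * (0:ℚ)) * b) ((s * (0:ℚ) + d * (1:ℚ)) * a + (s * (0:ℚ) + d * (0:ℚ)) * b)
      + ((1:ℚ)/2) * qf v ((s * (0:ℚ) + d * ((61:ℚ)/112)) * a + (s * (1:ℚ) + d * (0:ℚ)) * b) ((s * ((3:ℚ)/4) + d * (0:ℚ)) * a + (s * (0:ℚ) + d * ((13:ℚ)/24)) * b)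
      + ((55:ℚ)/32) * qf v ((s * (0:ℚ) + d * ((1019:ℚ)/4620)) * a + (s * (0:ℚ) + d * (0:ℚ)) * b) ((s * (1:ℚ) + d * (0:ℚ)) * a + (s * (0:ℚ) + d * ((149:ℚ)/770)) * b)
      + ((15613:ℚ)/97020) * qf v ((s * (0:ℚ) + d * (1:ℚ)) * a + (s * (0:ℚ) + d * (0:ℚ)) * b) ((s * (0:ℚ) + d * (0:ℚ)) * a + (s * (0:ℚ) + d * ((-249:ℚ)/1201)) * b)
      + ((73708:ℚ)/529641) * qf v ((s * (0:ℚ) + d * (0:ℚ)) * a + (s * (0:ℚ) + d * (0:ℚ)) * b) ((s * (0:ℚ) + d * (0:ℚ)) * a + (s * (0:ℚ) + d * (1:ℚ)) * b) := by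
  simp only [qf, i11, i22, i12, mSD]; ring

/-- ★ `L` is invariant under EVERY letter `M(s,d)` (`s, d` arbitrary rationals — physicality is NOT needed). [this work] -/
theorem inL_mSD (s d : ℚ) {v : V3} (hv : inL v) : inL (mSD s d v) := by
  intro a b
  rw [qf_mSD]
  have h0 := hv ((s * (1:ℚ) + d * (0:ℚ)) * a + (s * (0:ℚ) + d * ((5:ℚ)/392)) * b) ((s * (0:ℚ) + d * ((1:ℚ)/21)) * a + (s * ((1:ℚ)/2) + d * (0:ℚ)) * b)
  have h1 := hv ((s * (0:ℚ) + d * (0:ℚ)) * a + (s * (0:ℚ) + d * ((-31:ℚ)/420)) * b) ((s * (0:ℚ) + d * ((166:ℚ)/525)) * a + (s * (1:ℚ) + d * (0:ℚ)) * b)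
  have h2 := hv ((s * (0:ℚ) + d * (0:ℚ)) * a + (s * (0:ℚ) + d * (1:ℚ)) * b) ((s * (0:ℚ) + d * ((4396:ℚ)/4015)) * a + (s * (0:ℚ) + d * (0:ℚ)) * b)
  have h3 := hv ((s * (0:ℚ) + d * (0:ℚ)) * a + (s * (0:ℚ) + d * (0:ℚ)) * b) ((s * (0:ℚ) + d * (1:ℚ)) * a + (s * (0:ℚ) + d * (0:ℚ)) * b)
  have h4 := hv ((s * (0:ℚ) + d * ((61:ℚ)/112)) * a + (s * (1:ℚ) + d * (0:ℚ)) * b) ((s * ((3:ℚ)/4) + d * (0:ℚ)) * a + (s * (0:ℚ) + d * ((13:ℚ)/24)) * b)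
  have h5 := hv ((s * (0:ℚ) + d * ((1019:ℚ)/4620)) * a + (s * (0:ℚ) + d * (0:ℚ)) * b) ((s * (1:ℚ) + d * (0:ℚ)) * a + (s * (0:ℚ) + d * ((149:ℚ)/770)) * b)
  have h6 := hv ((s * (0:ℚ) + d * (1:ℚ)) * a + (s * (0:ℚ) + d * (0:ℚ)) * b) ((s * (0:ℚ) + d * (0:ℚ)) * a + (s * (0:ℚ) + d * ((-249:ℚ)/1201)) * b)
  have h7 := hv ((s * (0:ℚ) + d * (0:ℚ)) * a + (s * (0:ℚ) + d * (0:ℚ)) * b) ((s * (0:ℚ) + d * (0:ℚ)) * a + (s * (0:ℚ) + d * (1:ℚ)) * b)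
  have : (0:ℚ) ≤ ((7:ℚ)/4) * qf v ((s * (1:ℚ) + d * (0:ℚ)) * a + (s * (0:ℚ) + d * ((5:ℚ)/392)) * b) ((s * (0:ℚ) + d * ((1:ℚ)/21)) * a + (s * ((1:ℚ)/2) + d * (0:ℚ)) * b) + ((25:ℚ)/16) * qf v ((s * (0:ℚ) + d * (0:ℚ)) * a + (s * (0:ℚ) + d * ((-31:ℚ)/420)) * b) ((s * (0:ℚ) + d * ((166:ℚ)/525)) * a + (s * (1:ℚ) + d * (0:ℚ)) * b) + ((8833:ℚ)/98784) * qf v ((s * (0:ℚ) + d * (0:ℚ)) * a + (s * (0:ℚ) + d * (1:ℚ)) * b) ((s * (0:ℚ) + d * ((4396:ℚ)/4015)) * a + (s * (0:ℚ) + d * (0:ℚ)) * b) + ((1869121:ℚ)/1609650) * qf v ((s * (0:ℚ) + d * (0:ℚ)) * a + (s * (0:ℚ) + d * (0:ℚ)) * b) ((s * (0:ℚ) + d * (1:ℚ)) * a + (s * (0:ℚ) + d * (0:ℚ)) * b) + ((1:ℚ)/2) * qf v ((s * (0:ℚ) + d * ((61:ℚ)/112)) * a + (s * (1:ℚ) +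 d * (0:ℚ)) * b) ((s * ((3:ℚ)/4) + d * (0:ℚ)) * a + (s * (0:ℚ) + d * ((13:ℚ)/24)) * b) + ((55:ℚ)/32) * qf v ((s * (0:ℚ) + d * ((1019:ℚ)/4620)) * a + (s * (0:ℚ) + d * (0:ℚ)) * b) ((s * (1:ℚ) + d * (0:ℚ)) * a + (s * (0:ℚ) + d * ((149:ℚ)/770)) * b) + ((15613:ℚ)/97020) * qf v ((s * (0:ℚ) + d * (1:ℚ)) * a + (s * (0:ℚ) + d * (0:ℚ)) * b) ((s * (0:ℚ) + d * (0:ℚ)) * a + (s * (0:ℚ) + d * ((-249:ℚ)/1201)) * b) + ((73708:ℚ)/529641) * qf v ((s * (0:ℚ) + d * (0:ℚ)) * a + (s * (0:ℚ) + d * (0:ℚ)) * b) ((s * (0:ℚ) + d * (0:ℚ)) * a + (s * (0:ℚ) + d * (1:ℚ)) * b) := by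
    have g0 := mul_nonneg (by norm_num : (0:ℚ) ≤ ((7:ℚ)/4)) h0
    have g1 := mul_nonneg (by norm_num : (0:ℚ) ≤ ((25:ℚ)/16)) h1
    have g2 := mul_nonneg (by norm_num : (0:ℚ) ≤ ((8833:ℚ)/98784)) h2
    have g3 := mul_nonneg (by norm_num : (0:ℚ) ≤ ((1869121:ℚ)/1609650)) h3
    have g4 := mul_nonneg (by norm_num : (0:ℚ) ≤ ((1:ℚ)/2)) h4
    have g5 := mul_nonneg (by norm_num : (0:ℚ) ≤ ((55:ℚ)/32)) h5
    have g6 := mul_nonneg (by norm_num : (0:ℚ) ≤ ((15613:ℚ)/97020)) h6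
    have g7 := mul_nonneg (by norm_num : (0:ℚ) ≤ ((73708:ℚ)/529641)) h7
    linarith
  linarith

/-- `L` is invariant under every product of letters (`iterSD` of `…ModuleCone`, arbitrary rational letters). [this work] -/
theorem inL_iterSD (w : List (ℚ × ℚ)) {v : V3} (hv : inL v) : inL (iterSD w v) := by
  induction w with
  | nil => simpa [iterSD] using hv
  | cons θ w ih => simpa [iterSD] using inL_mSD θ.1 θ.2 ih

/-! ## 4. Physical letters: the column jumps lie in `−L`; cone law `col1, col2 ∈ −L` -/

/-- The negated jump of `col1` for the letter `(s,d)`: `−σ₁(s,d) = ((3/640)s² + (9/128)d², (3/160)s² − (3/160)d², (3/80)sd)`. [this work] -/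
def negJump1 (s d : ℚ) : V3 := ⟨(3/640) * s ^ 2 + (9/128) * d ^ 2, (3/160) * s ^ 2 - (3/160) * d ^ 2, (3/80) * (s * d)⟩

/-- The negated jump of `col2`: `−σ₂(s,d) = ((3s² − 59d²)/800, (12s² + 20d²)/800, 0)`. [this work] -/
def negJump2 (s d : ℚ) : V3 := ⟨(3 * s ^ 2 - 59 * d ^ 2) / 800, (12 * s ^ 2 + 20 * d ^ 2) / 800, 0⟩

/-- `qf` of `−σ₁(s,d)` in the corner variables `u = (s+d)/2`, `w = (s−d)/2`:
`= u²·[(3/10)a² + (9/40)ab + (3/40)b²] + 2uw·[(3/40)a² + (27/320)b²] + w²·[(3/10)a² − (9/40)ab + (3/40)b²]`, three PSD blocks. [this work] -/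
theorem qf_negJump1 (s d a b : ℚ) : qf (negJump1 s d) a b =
    ((s + d) / 2) ^ 2 * ((3/10) * a ^ 2 + (9/40) * a * b + (3/40) * b ^ 2)
    + 2 * ((s + d) / 2) * ((s - d) / 2) * ((3/40) * a ^ 2 + (27/320) * b ^ 2)
    + ((s - d) / 2) ^ 2 * ((3/10) * a ^ 2 - (9/40) * a * b + (3/40) * b ^ 2) := by
  simp only [qf, i11, i22, i12, negJump1]; ring

/-- `qf` of `−σ₂(s,d)`: `= u²·[(2/25)a² + (9/100)b²] + 2uw·[(11/50)a² + (3/80)b²] + w²·[(2/25)a² + (9/100)b²]`. [this work] -/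
theorem qf_negJump2 (s d a b : ℚ) : qf (negJump2 s d) a b =
    ((s + d) / 2) ^ 2 * ((2/25) * a ^ 2 + (9/100) * b ^ 2)
    + 2 * ((s + d) / 2) * ((s - d) / 2) * ((11/50) * a ^ 2 + (3/80) * b ^ 2)
    + ((s - d) / 2) ^ 2 * ((2/25) * a ^ 2 + (9/100) * b ^ 2) := by
  simp only [qf, i11, i22, i12, negJump2]; ring

/-- For a PHYSICAL letter (`0 ≤ s+d`, `0 ≤ s−d`) the negated `col1`-jump lies in `L`. [this work] -/
theorem inL_negJump1 (s d : ℚ) (hp : 0 ≤ s + d) (hm : 0 ≤ s - d) : inL (negJump1 s d) := by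
  intro a b
  rw [qf_negJump1]
  have q1 : 0 ≤ (3/10 : ℚ) * a ^ 2 + (9/40) * a * b + (3/40) * b ^ 2 := by nlinarith [sq_nonneg (2 * a + (3/4) * b), sq_nonneg b]
  have q2 : 0 ≤ (3/40 : ℚ) * a ^ 2 + (27/320) * b ^ 2 := by positivity
  have q3 : 0 ≤ (3/10 : ℚ) * a ^ 2 - (9/40) * a * b + (3/40) * b ^ 2 := by nlinarith [sq_nonneg (2 * a - (3/4) * b), sq_nonneg b]
  have huw : 0 ≤ 2 * ((s + d) / 2) * ((s - d) / 2) := by nlinarith [mul_nonneg hp hm]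
  have := mul_nonneg (sq_nonneg ((s + d) / 2)) q1
  have := mul_nonneg huw q2
  have := mul_nonneg (sq_nonneg ((s - d) / 2)) q3
  linarith

/-- For a PHYSICAL letter the negated `col2`-jump lies in `L`. [this work] -/
theorem inL_negJump2 (s d : ℚ) (hp : 0 ≤ s + d) (hm : 0 ≤ s - d) : inL (negJump2 s d) := by
  intro a b
  rw [qf_negJump2]
  have q1 : 0 ≤ (2/25 : ℚ) * a ^ 2 + (9/100) * b ^ 2 := by positivity
  have q2 : 0 ≤ (11/50 : ℚ) * a ^ 2 + (3/80) * b ^ 2 := by positivity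
  have huw : 0 ≤ 2 * ((s + d) / 2) * ((s - d) / 2) := by nlinarith [mul_nonneg hp hm]
  have := mul_nonneg (sq_nonneg ((s + d) / 2)) q1
  have := mul_nonneg huw q2
  have := mul_nonneg (sq_nonneg ((s - d) / 2)) q1
  linarith

/-- `−col1` after one physical step `= M(s,d)(−col1) + t·(−σ₁(s,d))`. [this work] -/
theorem neg_col1_bstepA (s d : ℚ) (v : StA) :
    (⟨-(col1 (bstepA s d v)).x, -(col1 (bstepA s d v)).y, -(col1 (bstepA s d v)).z⟩ : V3) =
      ⟨(mSD s d ⟨-(col1 v).x, -(col1 v).y, -(col1 v).z⟩).x + (⟨v.t * (negJump1 s d).x, v.t * (negJump1 s d).y, v.t * (negJump1 s d).z⟩ : V3).x,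
       (mSD s d ⟨-(col1 v).x, -(col1 v).y, -(col1 v).z⟩).y + (⟨v.t * (negJump1 s d).x, v.t * (negJump1 s d).y, v.t * (negJump1 s d).z⟩ : V3).y,
       (mSD s d ⟨-(col1 v).x, -(col1 v).y, -(col1 v).z⟩).z + (⟨v.t * (negJump1 s d).x, v.t * (negJump1 s d).y, v.t * (negJump1 s d).z⟩ : V3).z⟩ := by
  ext <;> simp [col1, bstepA, combA, stepA, mSD, negJump1] <;> ring

/-- `−col2` after one physical step `= M(s,d)(−col2) + t·(−σ₂(s,d))`. [this work] -/
theorem neg_col2_bstepA (s d : ℚ) (v : StA) :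
    (⟨-(col2 (bstepA s d v)).x, -(col2 (bstepA s d v)).y, -(col2 (bstepA s d v)).z⟩ : V3) =
      ⟨(mSD s d ⟨-(col2 v).x, -(col2 v).y, -(col2 v).z⟩).x + (⟨v.t * (negJump2 s d).x, v.t * (negJump2 s d).y, v.t * (negJump2 s d).z⟩ : V3).x,
       (mSD s d ⟨-(col2 v).x, -(col2 v).y, -(col2 v).z⟩).y + (⟨v.t * (negJump2 s d).x, v.t * (negJump2 s d).y, v.t * (negJump2 s d).z⟩ : V3).y,
       (mSD s d ⟨-(col2 v).x, -(col2 v).y, -(col2 v).z⟩).z + (⟨v.t * (negJump2 s d).x, v.t * (negJump2 s d).y, v.t * (negJump2 s d).z⟩ : V3).z⟩ := by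
  ext <;> simp [col2, bstepA, combA, stepA, mSD, negJump2] <;> ring

/-- ★ LAW C′ (round cone law): along every PHYSICAL word from `ω`, `t ≥ 0` and `−col1, −col2 ∈ L`. [this work] -/
theorem cols_negL (w : List (ℚ × ℚ)) (hw : ∀ θ ∈ w, 0 ≤ θ.1 + θ.2 ∧ 0 ≤ θ.1 - θ.2) :
    0 ≤ (brunA w omegaA).t ∧
    inL ⟨-(col1 (brunA w omegaA)).x, -(col1 (brunA w omegaA)).y, -(col1 (brunA w omegaA)).z⟩ ∧
    inL ⟨-(col2 (brunA w omegaA)).x, -(col2 (brunA w omegaA)).y, -(col2 (brunA w omegaA)).z⟩ := by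
  induction w with
  | nil =>
    refine ⟨by norm_num [brunA, omegaA], ?_, ?_⟩ <;>
      (intro a b; simp [qf, i11, i22, i12, brunA, omegaA, col1, col2])
  | cons θ w ih =>
    have hθ := hw θ (by simp)
    have hw' : ∀ θ' ∈ w, 0 ≤ θ'.1 + θ'.2 ∧ 0 ≤ θ'.1 - θ'.2 := fun θ' h => hw θ' (by simp [h])
    obtain ⟨ht, h1, h2⟩ := ih hw'
    refine ⟨?_, ?_, ?_⟩
    · show 0 ≤ (bstepA θ.1 θ.2 (brunA w omegaA)).t
      rw [t_bstepA]; positivity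
    · show inL ⟨-(col1 (bstepA θ.1 θ.2 (brunA w omegaA))).x, -(col1 (bstepA θ.1 θ.2 (brunA w omegaA))).y,
        -(col1 (bstepA θ.1 θ.2 (brunA w omegaA))).z⟩
      rw [neg_col1_bstepA]
      exact inL_add (inL_mSD θ.1 θ.2 h1) (inL_smul _ ht (inL_negJump1 θ.1 θ.2 hθ.1 hθ.2))
    · show inL ⟨-(col2 (bstepA θ.1 θ.2 (brunA w omegaA))).x, -(col2 (bstepA θ.1 θ.2 (brunA w omegaA))).y,
        -(col2 (bstepA θ.1 θ.2 (brunA w omegaA))).z⟩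
      rw [neg_col2_bstepA]
      exact inL_add (inL_mSD θ.1 θ.2 h2) (inL_smul _ ht (inL_negJump2 θ.1 θ.2 hθ.1 hθ.2))

/-! ## 5. ★ `β𝕄` is nonnegative on `L × L` (completely-positive certificate) -/

/-- The Krein form in the entries of `ι`: `β𝕄(u,v) = (19/3136)pp′ + (29/392)(pq′+qp′) + (3/49)qq′ + (1/9)rr′`
(`p = ι₁₁`, `q = ι₂₂`, `r = ι₁₂`). [this work] -/
theorem betaM_iota (u v : V3) : betaM u v =
    (19/3136) * (i11 u * i11 v) + (29/392) * (i11 u * i22 v + i22 u * i11 v) + (3/49) * (i22 u * i22 v)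
    + (1/9) * (i12 u * i12 v) := by
  simp only [betaM, i11, i22, i12]; ring

/-- ★ ACUTENESS OF `L`: `u, v ∈ L ⟹ β𝕄(u,v) ≥ 0` (because `(29/392)(pq′ + qp′) ≥ (29/196)|r||r′| ≥ (1/9)|r r′|`). [this work] -/
theorem betaM_nonneg_of_inL {u v : V3} (hu : inL u) (hv : inL v) : 0 ≤ betaM u v := by
  rw [betaM_iota]
  obtain ⟨hp, hq, hd⟩ := (inL_iff u).mp hu
  obtain ⟨hp', hq', hd'⟩ := (inL_iff v).mp hv
  set p := i11 u; set q := i22 u; set r := i12 u; set p' := i11 v; set q' := i22 v; set r' := i12 v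
  -- main inequality: (29/392)(p q' + q p') + (1/9) r r' ≥ 0
  have key : 0 ≤ (29/392) * (p * q' + q * p') + (1/9) * (r * r') := by
    by_cases hq0 : q = 0
    · have : r ^ 2 ≤ 0 := by rw [hq0, mul_zero] at hd; exact hd
      have hr : r = 0 := by nlinarith [sq_nonneg r]
      rw [hr, hq0]; nlinarith [mul_nonneg hp hq']
    by_cases hq0' : q' = 0
    · have : r' ^ 2 ≤ 0 := by rw [hq0', mul_zero] at hd'; exact hd'
      have hr' : r' = 0 := by nlinarith [sq_nonneg r']
      rw [hr', hq0']; nlinarith [mul_nonneg hq hp']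
    have hqq : 0 < q * q' := mul_pos (lt_of_le_of_ne hq (Ne.symm hq0)) (lt_of_le_of_ne hq' (Ne.symm hq0'))
    -- q q' · [ (29/392)(pq'+qp') + (1/9) r r' ] ≥ (29/392)(r² q'² + r'² q²) + (1/9) r r' q q' ≥ 0
    have h1 : r ^ 2 * q' ^ 2 ≤ p * q * q' ^ 2 := by nlinarith [sq_nonneg q']
    have h2 : r' ^ 2 * q ^ 2 ≤ p' * q' * q ^ 2 := by nlinarith [sq_nonneg q]
    have h3 : 0 ≤ (29/392 : ℚ) * (r ^ 2 * q' ^ 2 + r' ^ 2 * q ^ 2) + (1/9) * (r * r') * (q * q') := by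
      nlinarith [sq_nonneg (r * q' + r' * q), sq_nonneg (r * q' - r' * q)]
    have h4 : 0 ≤ (q * q') * ((29/392) * (p * q' + q * p') + (1/9) * (r * r')) := by nlinarith
    exact (mul_nonneg_iff_of_pos_left hqq).mp h4
  nlinarith [mul_nonneg hp hp', mul_nonneg hq hq']

end Summit.CriticalPhenomena.PercolationContinuityZ3.Theorems.ProductFormModuleCP
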